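import Mathlib.Probability.Distributions.Gaussian.Real
import Mathlib.MeasureTheory.Measure.CharacteristicFunction.TaylorExpansion
import HarnessLib

/-!
# Gaussian moments with a phase: the one-coordinate computation behind Borgs–Seiler's
# double-commutator bound

First of three theorem-only support files for the proof of Borgs–Seiler's explicit infrared bound
(`Literature.Barriers.QuantumFields.BorgsSeilerInfraredBoundExplicit`, Commun. Math. Phys. 91 (1983),
Lemma III.6). Borgs–Seiler embed the unitary link variables `u ∈ U(N) ⊂ ℂ^{N²}` and conjugate
the multiplication operators by the Gaussian convolution `t`, kernel `exp(-(J_E/2)‖u - u'‖²)`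
((III.37), (III.46)); in Fourier variables this is the identity `t⁻¹ u_{ab} t = u_{ab} + (2/J_E) ∂/∂ū_{ab}`
((III.47)–(III.48)). In the tree's operator-free rendering (`FiniteTemperatureInfraredGramKernel.lean`)
the same content is the following elementary Gaussian computation, one complex coordinate
`κ = x + iy` at a time (`x, y` independent `N(0, J)`): for `c, u, v, α, β ∈ ℂ`,

  `∫ e^{i Re(κ c̄)} (u + α κ̄)(v + β κ) dγ = e^{-J|c|²/2} ((u + iJα c̄)(v + iJβ c) + 2Jαβ)`

(`integral_phase_mul_affine_mul_affine`): the term `2Jαβ` is the CONTRACTION (the canonical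
commutation relation `[∂, k] = 1`, i.e. the `2/J_E` of (III.48)), everything else is the "naive
substitution" `κ ↦ iJc`, `κ̄ ↦ iJc̄`.

## Contents (all proved; no definitions beyond concrete functions/measures, no named facts)

* `gw J t = e^{-J t²/2}` and the one-dimensional moments with a phase under `gaussianReal 0 J`:
  `moment_zero/one/two` (`∫ e^{itx} = gw`, `∫ x e^{itx} = iJt·gw`, `∫ x² e^{itx} = (J - J²t²)·gw`),
  from Mathlib's `charFun_gaussianReal` and `iteratedDeriv_charFun`.
* `γ₂ J` (the law of one complex coordinate), `kapz z = z.1 + i z.2`, `phase c z = e^{i Re(κ c̄)}`,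
  the computation above and the integrability of its integrand.
* `dom₂ J m z = (1 + |x|/J)^m (1 + |y|/J)^m`, an integrable dominating function with
  `(1 + |κ|/J)^m ≤ dom₂` (used for Fubini downstream).

References: C. Borgs, E. Seiler, Commun. Math. Phys. 91 (1983) 329–380, §III.2 (III.37),
(III.46)–(III.48) (pp. 349–351). [BorgsSeiler1983]
-/

noncomputable section

open MeasureTheory Complex ProbabilityTheory
open scoped ComplexConjugate

namespace Literature.Barriers.QuantumFields.InfraredGaussian

/-! ### One-dimensional Gaussian moments with a phase -/

section OneDim

variable (J : NNReal)

/-- The Gaussian weight `gw J t = e^{-J t²/2}` (the characteristic function of `N(0, J)`), as a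
complex function of a real variable. [folklore] -/
def gw (t : ℝ) : ℂ := cexp (-(J : ℂ) * (t : ℂ) ^ 2 / 2)

/-- `d/dt e^{-Jt²/2} = -Jt e^{-Jt²/2}`. [folklore] -/
theorem hasDerivAt_gw (t : ℝ) : HasDerivAt (gw J) (gw J t * (-(J : ℂ) * t)) t := by
  have h1 : HasDerivAt (fun y : ℝ => ((y : ℝ) : ℂ)) ((1 : ℝ) : ℂ) t := (hasDerivAt_id t).ofReal_comp
  have h2 : HasDerivAt (fun y : ℝ => -(J : ℂ) * ((y : ℂ)) ^ 2 / 2) (-(J : ℂ) * (2 * (t : ℂ) * 1) / 2) t := by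
    have := (h1.pow 2).const_mul (-(J : ℂ))
    have := this.div_const 2
    simpa using this
  have h3 := h2.cexp
  unfold gw
  exact h3.congr_deriv (by ring)

/-- The derivative of `gw` as a function. [folklore] -/
theorem deriv_gw : deriv (gw J) = fun t => gw J t * (-(J : ℂ) * t) :=
  funext fun t => (hasDerivAt_gw J t).deriv

/-- `d²/dt² e^{-Jt²/2} = (J²t² - J) e^{-Jt²/2}`. [folklore] -/
theorem hasDerivAt_deriv_gw (t : ℝ) :
    HasDerivAt (deriv (gw J)) (gw J t * ((J : ℂ) ^ 2 * t ^ 2 - J)) t := by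
  rw [deriv_gw]
  have h1 : HasDerivAt (fun y : ℝ => ((y : ℝ) : ℂ)) ((1 : ℝ) : ℂ) t := (hasDerivAt_id t).ofReal_comp
  have h2 : HasDerivAt (fun y : ℝ => -(J : ℂ) * (y : ℂ)) (-(J : ℂ) * 1) t := by
    simpa using h1.const_mul (-(J : ℂ))
  have h3 := (hasDerivAt_gw J t).mul h2
  exact h3.congr_deriv (by ring)

/-- The characteristic function of `N(0, J)` is `gw J` (Mathlib `charFun_gaussianReal`). [folklore] -/
theorem charFun_gaussian_eq_gw : charFun (gaussianReal 0 J) = gw J := by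
  funext t
  rw [charFun_gaussianReal]
  unfold gw
  congr 1
  push_cast
  ring

/-- `∫ e^{itx} dγ_J(x) = e^{-J t²/2}`. [folklore] -/
theorem moment_zero (t : ℝ) :
    ∫ x, cexp (t * x * I) ∂(gaussianReal 0 J) = gw J t := by
  rw [← charFun_apply_real, charFun_gaussian_eq_gw]

/-- `∫ x e^{itx} dγ_J(x) = i J t e^{-J t²/2}` (first derivative of the characteristic function).
[folklore] -/
theorem moment_one (t : ℝ) :
    ∫ x, (x : ℂ) * cexp (t * x * I) ∂(gaussianReal 0 J) = I * J * t * gw J t := by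
  have hmem : MemLp id ((1 : ℕ) : ENNReal) (gaussianReal 0 J) := by
    simpa using memLp_id_gaussianReal (μ := 0) (v := J) 1
  have h := iteratedDeriv_charFun (μ := gaussianReal 0 J) (n := 1) (t := t) hmem
  rw [iteratedDeriv_one, charFun_gaussian_eq_gw, deriv_gw] at h
  simp only [pow_one] at h
  have hI : (I : ℂ) ≠ 0 := I_ne_zero
  have key : I * (I * J * t * gw J t) = gw J t * (-(J : ℂ) * t) := by
    have : (I : ℂ) * I = -1 := by rw [← sq, I_sq]
    linear_combination (J : ℂ) * t * gw J t * this
  rw [← key] at h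
  exact mul_left_cancel₀ hI h.symm

/-- `∫ x² e^{itx} dγ_J(x) = (J - J² t²) e^{-J t²/2}` (second derivative of the characteristic
function). [folklore] -/
theorem moment_two (t : ℝ) :
    ∫ x, (x : ℂ) ^ 2 * cexp (t * x * I) ∂(gaussianReal 0 J) = ((J : ℂ) - (J : ℂ) ^ 2 * t ^ 2) * gw J t := by
  have hmem : MemLp id ((2 : ℕ) : ENNReal) (gaussianReal 0 J) := by
    simpa using memLp_id_gaussianReal (μ := 0) (v := J) 2
  have h := iteratedDeriv_charFun (μ := gaussianReal 0 J) (n := 2) (t := t) hmem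
  rw [iteratedDeriv_succ, iteratedDeriv_one, charFun_gaussian_eq_gw,
    (hasDerivAt_deriv_gw J t).deriv] at h
  have hI2 : (I : ℂ) ^ 2 = -1 := I_sq
  rw [hI2] at h
  have key : (-1 : ℂ) * (((J : ℂ) - (J : ℂ) ^ 2 * t ^ 2) * gw J t) =
      gw J t * ((J : ℂ) ^ 2 * t ^ 2 - J) := by ring
  rw [← key] at h
  exact mul_left_cancel₀ (by norm_num) h.symm

/-- Integrability of `x ↦ x^m e^{itx}` under the Gaussian (all moments exist). [folklore] -/
theorem integrable_pow_mul_phase (m : ℕ) (t : ℝ) :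
    Integrable (fun x : ℝ => (x : ℂ) ^ m * cexp (t * x * I)) (gaussianReal 0 J) := by
  have hmem : MemLp id ((m : ℕ) : ENNReal) (gaussianReal 0 J) := by
    simpa using memLp_id_gaussianReal (μ := 0) (v := J) m
  have h := hmem.integrable_norm_pow'
  refine h.mono' (by fun_prop) (ae_of_all _ fun x => ?_)
  have hph : ‖cexp (↑t * ↑x * I)‖ = 1 := by
    rw [show (↑t * ↑x * I : ℂ) = ((t * x : ℝ) : ℂ) * I by push_cast; ring, norm_exp_ofReal_mul_I]
  rw [norm_mul, hph, mul_one, norm_pow, Complex.norm_real]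
  simp

/-- `gw (Re c) * gw (Im c) = e^{-J |c|²/2}`. [folklore] -/
theorem gw_re_mul_gw_im (c : ℂ) : gw J c.re * gw J c.im = cexp (-(J : ℂ) * Complex.normSq c / 2) := by
  unfold gw
  rw [← Complex.exp_add]
  congr 1
  rw [Complex.normSq_apply]
  push_cast
  ring

/-- Integrability of `(1 + |x|/J)^m` under the Gaussian (expand binomially). [folklore] -/
theorem integrable_one_add_abs_div_pow (m : ℕ) :
    Integrable (fun x : ℝ => (1 + |x| / J) ^ m) (gaussianReal 0 J) := by
  have h : ∀ x : ℝ, (1 + |x| / J) ^ m =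
      ∑ j ∈ Finset.range (m + 1), (m.choose j : ℝ) * ((J : ℝ)⁻¹ ^ j * |x| ^ j) := by
    intro x
    rw [add_comm, add_pow]
    refine Finset.sum_congr rfl fun j _ => ?_
    rw [one_pow, mul_one, div_eq_mul_inv, mul_pow]; ring
  simp_rw [h]
  refine integrable_finsetSum _ fun j _ => Integrable.const_mul (Integrable.const_mul ?_ _) _
  have hmem : MemLp id ((j : ℕ) : ENNReal) (gaussianReal 0 J) := by
    simpa using memLp_id_gaussianReal (μ := 0) (v := J) j
  simpa using hmem.integrable_norm_pow'

end OneDim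

/-! ### One complex coordinate: two independent Gaussians -/

section TwoDim

variable (J : NNReal)

/-- The law `γ₂ J` of one complex Gaussian coordinate `κ = x + iy`: `x, y` independent `N(0, J)`
(covariance `J` per real coordinate, the Fourier dual of Borgs–Seiler's kernel `e^{-(J/2)|u-u'|²}`,
(III.46)). [cite: BorgsSeiler1983, §III.2 (III.46)–(III.47) (p. 350–351)] -/
def γ₂ : Measure (ℝ × ℝ) := (gaussianReal 0 J).prod (gaussianReal 0 J)

/-- `γ₂` is a probability measure. [folklore] -/
instance isProbabilityMeasure_γ₂ : IsProbabilityMeasure (γ₂ J) := by unfold γ₂; infer_instance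

/-- The phase `e^{i Re(κ c̄)} = e^{i (x Re c + y Im c)}`. [folklore] -/
def phase (c : ℂ) (z : ℝ × ℝ) : ℂ := cexp (c.re * z.1 * I) * cexp (c.im * z.2 * I)

/-- The complex coordinate `κ = x + i y`. [folklore] -/
def kapz (z : ℝ × ℝ) : ℂ := (z.1 : ℂ) + (z.2 : ℂ) * I

/-- `κ̄ = x - iy`. [folklore] -/
theorem conj_kapz (z : ℝ × ℝ) : conj (kapz z) = (z.1 : ℂ) - (z.2 : ℂ) * I := by
  unfold kapz
  simp [Complex.ext_iff]

/-- `κ` is continuous. [folklore] -/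
@[fun_prop] theorem continuous_kapz : Continuous kapz := by unfold kapz; fun_prop

/-- Mixed moments `∫ x^m y^n e^{i(x Re c + y Im c)}` factor into one-dimensional moments
(independence). [folklore] -/
theorem integral_pow_pow_phase (c : ℂ) (m n : ℕ) :
    ∫ z, (z.1 : ℂ) ^ m * (z.2 : ℂ) ^ n * phase c z ∂(γ₂ J) =
      (∫ x, (x : ℂ) ^ m * cexp (c.re * x * I) ∂(gaussianReal 0 J)) *
        (∫ y, (y : ℂ) ^ n * cexp (c.im * y * I) ∂(gaussianReal 0 J)) := by
  unfold γ₂ phase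
  rw [← integral_prod_mul]
  congr 1
  funext z
  ring

/-- Integrability of the mixed moments. [folklore] -/
theorem integrable_pow_pow_phase (c : ℂ) (m n : ℕ) :
    Integrable (fun z : ℝ × ℝ => (z.1 : ℂ) ^ m * (z.2 : ℂ) ^ n * phase c z) (γ₂ J) := by
  have h := (integrable_pow_mul_phase J m c.re).mul_prod (integrable_pow_mul_phase J n c.im)
  unfold γ₂ phase
  refine h.congr (ae_of_all _ fun z => ?_)
  simp only
  ring

/-- Expansion of the one-coordinate integrand into monomials. [folklore] -/
theorem phase_mul_affine_mul_affine_eq (c u v α β : ℂ) (z : ℝ × ℝ) :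
    phase c z * ((u + α * conj (kapz z)) * (v + β * kapz z)) =
      u * v * ((z.1 : ℂ) ^ 0 * (z.2 : ℂ) ^ 0 * phase c z) +
      (u * β + α * v) * ((z.1 : ℂ) ^ 1 * (z.2 : ℂ) ^ 0 * phase c z) +
      I * (u * β - α * v) * ((z.1 : ℂ) ^ 0 * (z.2 : ℂ) ^ 1 * phase c z) +
      α * β * ((z.1 : ℂ) ^ 2 * (z.2 : ℂ) ^ 0 * phase c z) +
      α * β * ((z.1 : ℂ) ^ 0 * (z.2 : ℂ) ^ 2 * phase c z) := by
  rw [conj_kapz]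
  unfold kapz
  have hI : (I : ℂ) * I = -1 := by rw [← sq, I_sq]
  linear_combination (-(α * β * (z.2 : ℂ) ^ 2 * phase c z)) * hI

/-- Integrability of the one-coordinate integrand `e^{i Re(κ c̄)} (u + α κ̄)(v + β κ)`. [folklore] -/
theorem integrable_phase_mul_affine_mul_affine (c u v α β : ℂ) :
    Integrable (fun z => phase c z * ((u + α * conj (kapz z)) * (v + β * kapz z))) (γ₂ J) := by
  simp_rw [phase_mul_affine_mul_affine_eq]
  have hi := integrable_pow_pow_phase J c
  exact (((((hi 0 0).const_mul _).add ((hi 1 0).const_mul _)).add ((hi 0 1).const_mul _)).add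
    ((hi 2 0).const_mul _)).add ((hi 0 2).const_mul _)

/-- The one-coordinate Gaussian computation, raw form in terms of `Re c`, `Im c`. [folklore] -/
theorem integral_phase_mul_affine_mul_affine_aux (c u v α β : ℂ) :
    ∫ z, phase c z * ((u + α * conj (kapz z)) * (v + β * kapz z)) ∂(γ₂ J) =
      gw J c.re * gw J c.im *
        ((u + I * J * α * ((c.re : ℂ) - (c.im : ℂ) * I)) * (v + I * J * β * ((c.re : ℂ) + (c.im : ℂ) * I))
          + 2 * J * α * β) := by
  simp_rw [phase_mul_affine_mul_affine_eq]
  have hi := integrable_pow_pow_phase J c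
  rw [integral_add, integral_add, integral_add, integral_add]
  rotate_left
  · exact (hi 0 0).const_mul _
  · exact (hi 1 0).const_mul _
  · exact ((hi 0 0).const_mul _).add ((hi 1 0).const_mul _)
  · exact (hi 0 1).const_mul _
  · exact (((hi 0 0).const_mul _).add ((hi 1 0).const_mul _)).add ((hi 0 1).const_mul _)
  · exact (hi 2 0).const_mul _
  · exact ((((hi 0 0).const_mul _).add ((hi 1 0).const_mul _)).add ((hi 0 1).const_mul _)).add
      ((hi 2 0).const_mul _)
  · exact (hi 0 2).const_mul _
  simp only [integral_const_mul, integral_pow_pow_phase]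
  simp only [pow_zero, one_mul, pow_one, moment_zero, moment_one, moment_two]
  have hI : (I : ℂ) * I = -1 := by rw [← sq, I_sq]
  set g1 := gw J c.re
  set g2 := gw J c.im
  set p : ℂ := (c.re : ℂ)
  set q : ℂ := (c.im : ℂ)
  linear_combination (g1 * g2 * α * β * (J : ℂ) ^ 2 * (q ^ 2 * (I ^ 2 - 1) - p ^ 2)) * hI

/-- **The one-coordinate Gaussian computation**: for `c u v α β : ℂ`,
`∫ e^{i Re(κ c̄)} (u + α κ̄)(v + β κ) dγ₂ = e^{-J|c|²/2} ((u + iJα c̄)(v + iJβ c) + 2Jαβ)`.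
The term `2Jαβ` is the contraction — Borgs–Seiler's `(2/J_E) ∂/∂ū` of (III.48) in disguise. [cite: BorgsSeiler1983, §III.2 (III.47)–(III.48) (p. 351)] -/
theorem integral_phase_mul_affine_mul_affine (c u v α β : ℂ) :
    ∫ z, phase c z * ((u + α * conj (kapz z)) * (v + β * kapz z)) ∂(γ₂ J) =
      cexp (-(J : ℂ) * Complex.normSq c / 2) *
        ((u + I * J * α * conj c) * (v + I * J * β * c) + 2 * J * α * β) := by
  rw [integral_phase_mul_affine_mul_affine_aux, gw_re_mul_gw_im]
  have hc : ((c.re : ℂ) + (c.im : ℂ) * I) = c := Complex.re_add_im c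
  have hcc : ((c.re : ℂ) - (c.im : ℂ) * I) = conj c := by
    rw [Complex.ext_iff]; simp
  rw [hc, hcc]

/-! ### Dominating functions -/

/-- The per-coordinate dominating function `dom₂ J m (x, y) = (1 + |x|/J)^m (1 + |y|/J)^m`.
[folklore] -/
def dom₂ (m : ℕ) (z : ℝ × ℝ) : ℝ := (1 + |z.1| / J) ^ m * (1 + |z.2| / J) ^ m

/-- `(1 + |κ|/J)^m ≤ dom₂ J m`. [folklore] -/
theorem one_add_norm_kapz_div_pow_le (m : ℕ) (z : ℝ × ℝ) :
    (1 + ‖kapz z‖ / J) ^ m ≤ dom₂ J m z := by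
  unfold dom₂
  rw [← mul_pow]
  refine pow_le_pow_left₀ (by positivity) ?_ m
  have hk : ‖kapz z‖ ≤ |z.1| + |z.2| := by
    unfold kapz
    refine (norm_add_le _ _).trans ?_
    rw [norm_mul, Complex.norm_I, mul_one, Complex.norm_real, Complex.norm_real, Real.norm_eq_abs,
      Real.norm_eq_abs]
  have h1 : 0 ≤ |z.1| / J := by positivity
  have h2 : 0 ≤ |z.2| / J := by positivity
  calc 1 + ‖kapz z‖ / J ≤ 1 + (|z.1| + |z.2|) / J := by
        rw [div_eq_mul_inv, div_eq_mul_inv]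
        nlinarith [norm_nonneg (kapz z), inv_nonneg.2 J.coe_nonneg]
    _ ≤ (1 + |z.1| / J) * (1 + |z.2| / J) := by rw [add_div]; nlinarith

/-- `dom₂` is `γ₂`-integrable. [folklore] -/
theorem integrable_dom₂ (m : ℕ) : Integrable (dom₂ J m) (γ₂ J) := by
  unfold dom₂ γ₂
  exact (integrable_one_add_abs_div_pow J m).mul_prod (integrable_one_add_abs_div_pow J m)

end TwoDim

end Literature.Barriers.QuantumFields.InfraredGaussian

end
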